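import Mathlib.Algebra.Field.ZMod
import Mathlib.Data.Nat.Prime.Int
import Mathlib.Algebra.Ring.Divisibility.Basic
import Mathlib.Tactic.Ring
import Mathlib.Tactic.LinearCombination
import HarnessLib

/-!
# Venture HSemireg — S4-PUSH corner 2 (twisted sheaves ∕ complexes at `n = 6`), seat `gs-eng-2` (gen 23):
# KERNEL LEG for the LOCAL ARITHMETIC of the degree-4 modelling step (D2) of the dual sieve
# (cell record: s4-search-2's `s4push/search-2/PREREG-S2-17.md` §1 (D2); this seat's `general-structure/XCHECK-K0-gs2.md` §4 (i)–(ii))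

HONEST FRAMING. Count-neutral infrastructure; elementary divisibility over `ℤ` at a prime `p`. What is NOT
formalised here: the lattice-to-coordinates translation ((D1): `p · e^{−B′} w ∈ ∧Λ_Y^∨ ⟺ (e^{−B′} w)_d ∈
p^{d−1} ∧^d Λ′^∨`, and the STRUCTURE LEMMA `w = Σ σ_k D^{[k]}`). What IS formalised: once the degree-2 and
degree-4 components are read coefficientwise in a `D`-adapted symplectic basis of `Λ′` — degree 2:
`σ₀ · B′_{xy} ≡ 0 (mod p)`; degree 4 on the slot pair `{a_i,b_i,a_j,b_j}`: `u · p^M + σ₀ · p² · Y ≡ 0 (mod p³)`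
with `u := σ₂ p^{−v}` and `σ₀` prime to `p`, `M := v + c′_i + c′_j`, `Y := (B″^{[2]})_{ij} ∈ ℤ`; degree 4 on
every other basis 4-subset `T`: `σ₀ · p² · Y_T ≡ 0 (mod p³)` — the conclusions (D2) draws are exactly the
four divisibility facts below (stated for a general exponent `K` in place of `2`; negative types `c′ ≥ −1`
are covered by clearing the denominator `p²` first, i.e. reading the same facts with `K = 4`, `M + 2`):
* `le_exp_of_pow_succ_dvd`       — (i):  `p^{K+1} ∣ u p^M + s p^K Y`, `p ∤ u`  ⟹  `K ≤ M`;
* `dvd_add_mul_of_exp_eq`        — (ii) on an edge of `E` (`M = K`):  `p ∣ u + s Y`, i.e. `Y ≡ −u∕s =: κ`;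
* `dvd_of_exp_lt`                — (ii) off `E` (`M > K`), `p ∤ s`:  `p ∣ Y`;
* `dvd_of_pow_succ_dvd_mul`      — (ii) on the 4-subsets that are not slot pairs:  `p^{K+1} ∣ s p^K Y`, `p ∤ s` ⟹ `p ∣ Y`;
* `dvd_of_dvd_unit_mul`          — degree 2:  `p ∣ s X`, `p ∤ s` ⟹ `p ∣ X` (so `B′ = p B″` on `Λ′`);
* `zmod_eq_kappa` ∕ `kappa_ne_zero` — the same read in `𝔽_p`: on `E` the reduced coefficient IS `κ = −u∕s`,
  a NON-ZERO element of `𝔽_p` — the input «`B̄″^{[2]} = κ · Ω_E`, `κ ≠ 0`» of the divided-square lemma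
  (`DividedSquareLemma.lean`, s4-search-2 g12) and of `DividedSquareUniqueness.lean` (this seat).
Nothing here says HC ∕ HC_CM ∕ HC_AV holds; no object, no `σ`, no census count moves.
-/

namespace Summit.Ventures.HSemireg.DualSieveDegreeFour

variable {p : ℕ} [hp : Fact p.Prime]

/-- `p` is prime as an integer. -/
private theorem prime_int : Prime (p : ℤ) := Nat.prime_iff_prime_int.mp hp.out

/-- Powers of `p` are non-zero integers. -/
private theorem pow_ne_zero_int (n : ℕ) : (p : ℤ) ^ n ≠ 0 :=
  pow_ne_zero n (by exact_mod_cast hp.out.ne_zero)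

/-- **(D2)(i): the exponent inequality.** If `p^{K+1} ∣ u · p^M + s · p^K · Y` with `p ∤ u`, then `K ≤ M`
(a term of valuation `M < K` cannot be cancelled by terms of valuation `≥ K`). In the sieve: `K = 2`,
`M = v_p(σ₂) + c′_i + c′_j`, so every pair sum satisfies `v + c′_i + c′_j ≥ 2`. -/
theorem le_exp_of_pow_succ_dvd {u s Y : ℤ} {K M : ℕ} (hu : ¬ (p : ℤ) ∣ u)
    (h : (p : ℤ) ^ (K + 1) ∣ u * (p : ℤ) ^ M + s * (p : ℤ) ^ K * Y) : K ≤ M := by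
  by_contra hlt
  rw [not_le] at hlt
  -- p^{M+1} divides p^{K+1} and p^K, hence u · p^M, hence p ∣ u
  have h1 : (p : ℤ) ^ (M + 1) ∣ (p : ℤ) ^ (K + 1) := pow_dvd_pow _ (by omega)
  have h2 : (p : ℤ) ^ (M + 1) ∣ s * (p : ℤ) ^ K * Y :=
    (Dvd.dvd.mul_left (pow_dvd_pow (p : ℤ) (by omega : M + 1 ≤ K)) s).mul_right Y
  have h3 : (p : ℤ) ^ (M + 1) ∣ u * (p : ℤ) ^ M := by
    have := dvd_sub (h1.trans h) h2
    simpa using this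
  rw [pow_succ, mul_comm u] at h3
  exact hu ((mul_dvd_mul_iff_left (pow_ne_zero_int M)).mp h3)

/-- **(D2)(ii) on an edge** (`M = K`, i.e. `v + c′_i + c′_j = 2`): `p ∣ u + s · Y` — the reduced Pfaffian
coordinate `Ȳ` equals `κ := −u∕s` in `𝔽_p`. -/
theorem dvd_add_mul_of_exp_eq {u s Y : ℤ} {K : ℕ}
    (h : (p : ℤ) ^ (K + 1) ∣ u * (p : ℤ) ^ K + s * (p : ℤ) ^ K * Y) : (p : ℤ) ∣ u + s * Y := by
  have e : u * (p : ℤ) ^ K + s * (p : ℤ) ^ K * Y = (p : ℤ) ^ K * (u + s * Y) := by ring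
  rw [e, pow_succ] at h
  exact (mul_dvd_mul_iff_left (pow_ne_zero_int K)).mp h

/-- **(D2)(ii) off the edge set** (`M > K`, i.e. `v + c′_i + c′_j ≥ 3`): with `p ∤ s`, `p ∣ Y` — the reduced
Pfaffian coordinate vanishes. -/
theorem dvd_of_exp_lt {u s Y : ℤ} {K M : ℕ} (hs : ¬ (p : ℤ) ∣ s) (hKM : K < M)
    (h : (p : ℤ) ^ (K + 1) ∣ u * (p : ℤ) ^ M + s * (p : ℤ) ^ K * Y) : (p : ℤ) ∣ Y := by
  have h1 : (p : ℤ) ^ (K + 1) ∣ u * (p : ℤ) ^ M :=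
    Dvd.dvd.mul_left (pow_dvd_pow (p : ℤ) (by omega : K + 1 ≤ M)) u
  have h2 : (p : ℤ) ^ (K + 1) ∣ s * (p : ℤ) ^ K * Y := by
    have := dvd_sub h h1
    simpa using this
  have e : s * (p : ℤ) ^ K * Y = (p : ℤ) ^ K * (s * Y) := by ring
  rw [e, pow_succ] at h2
  have h3 : (p : ℤ) ∣ s * Y := (mul_dvd_mul_iff_left (pow_ne_zero_int K)).mp h2
  exact (prime_int.dvd_or_dvd h3).resolve_left hs

/-- **(D2)(ii) on a basis 4-subset that is not a slot pair**: there the `D^{[2]}`-term is absent, the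
condition reads `p^{K+1} ∣ s · p^K · Y`, and with `p ∤ s` the reduced coordinate vanishes: `p ∣ Y`. -/
theorem dvd_of_pow_succ_dvd_mul {s Y : ℤ} {K : ℕ} (hs : ¬ (p : ℤ) ∣ s)
    (h : (p : ℤ) ^ (K + 1) ∣ s * (p : ℤ) ^ K * Y) : (p : ℤ) ∣ Y := by
  have e : s * (p : ℤ) ^ K * Y = (p : ℤ) ^ K * (s * Y) := by ring
  rw [e, pow_succ] at h
  exact (prime_int.dvd_or_dvd ((mul_dvd_mul_iff_left (pow_ne_zero_int K)).mp h)).resolve_left hs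

/-- **(D2), degree 2**: `(e^{−B′} w)₂ = −σ₀ B′ ∈ p ∧²Λ′^∨` with `σ₀` prime to `p` gives `B′ ≡ 0 (mod p)` on `Λ′`
coefficientwise: `p ∣ s · X`, `p ∤ s` ⟹ `p ∣ X`. -/
theorem dvd_of_dvd_unit_mul {s X : ℤ} (hs : ¬ (p : ℤ) ∣ s) (h : (p : ℤ) ∣ s * X) : (p : ℤ) ∣ X :=
  (prime_int.dvd_or_dvd h).resolve_left hs

/-- **The `𝔽_p` reading on an edge**: from `p ∣ u + s · Y` with `p ∤ s`, the class of `Y` in `ZMod p` is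
`κ := −ū · s̄⁻¹`. -/
theorem zmod_eq_kappa {u s Y : ℤ} (hs : ¬ (p : ℤ) ∣ s) (h : (p : ℤ) ∣ u + s * Y) :
    (Y : ZMod p) = -(u : ZMod p) * (s : ZMod p)⁻¹ := by
  have hs' : (s : ZMod p) ≠ 0 := by
    rwa [Ne, ZMod.intCast_zmod_eq_zero_iff_dvd]
  have h0 : ((u + s * Y : ℤ) : ZMod p) = 0 := (ZMod.intCast_zmod_eq_zero_iff_dvd _ p).mpr h
  push_cast at h0
  rw [eq_mul_inv_iff_mul_eq₀ hs']
  linear_combination h0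

/-- **`κ ≠ 0`**: with `p ∤ u` and `p ∤ s`, `κ = −ū · s̄⁻¹` is a non-zero element of `𝔽_p` — the hypothesis
«`κ ≠ 0`» under which `DividedSquareLemma.lean` ∕ `DividedSquareUniqueness.lean` are applied. -/
theorem kappa_ne_zero {u s : ℤ} (hu : ¬ (p : ℤ) ∣ u) (hs : ¬ (p : ℤ) ∣ s) :
    -(u : ZMod p) * (s : ZMod p)⁻¹ ≠ 0 := by
  have hu' : (u : ZMod p) ≠ 0 := by rwa [Ne, ZMod.intCast_zmod_eq_zero_iff_dvd]
  have hs' : (s : ZMod p) ≠ 0 := by rwa [Ne, ZMod.intCast_zmod_eq_zero_iff_dvd]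
  exact mul_ne_zero (neg_ne_zero.mpr hu') (inv_ne_zero hs')

end Summit.Ventures.HSemireg.DualSieveDegreeFour
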